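import Mathlib
import Literature.AlgebraicGeometry.Resolution.RsopMonomialIdeals

/-!
# TropicalLinks / InductiveStep — the boundary components are discrete valuation rings

Route `ResolutionOfSingularities/TropicalLinks`, crux `InductiveStep` (stmt-ResolutionOfSingularities-17233),
line `split`, brick ORD, in support of the geometric producer `stub_valuativeCharts`.

`R` is a chart ring of the regular projective closure `Ȳ` and `t ∈ R` the equation of the hyperplane
at infinity `H∞` on that chart. The hypothesis is the strict-normal-crossings clause of the datum: at
every prime `Q ∋ t` the local ring `R_Q` is regular and carries a part `x₁, …, x_r` (`r ≥ 1`) of a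
regular system of parameters with `√(t) = (∏ x_l)`.

* `tropicalLinks_isDiscreteValuationRing_of_sncClause` — **the local ring `R_q` at every minimal
  prime `q` over `(t)` (the generic point of an irreducible component of `H∞ ∩ Ȳ`) is a discrete
  valuation ring.**  Proof: `q` is minimal over a principal ideal, so `ht q ≤ 1` (Krull's
  Hauptidealsatz, `Ideal.height_le_one_of_isPrincipal_of_mem_minimalPrimes`) and
  `dim R_q = ht q ≤ 1` (`IsLocalization.AtPrime.ringKrullDim_eq_height`).  By the clause `R_q` is a
  regular local ring, so its maximal ideal needs `dim R_q ≤ 1` generators and `R_q` is a principal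
  ideal ring (`tfae_of_isNoetherianRing_of_isLocalRing_of_isDomain`); it is not a field because the
  member `x₁ ≠ 0` of the part lies in the maximal ideal.

These rings are the "orders of vanishing along the old boundary components" `ord_D : K → ℤ` used by
the line.
-/

-- single-problem summit: the doubled namespace component `ResolutionOfSingularities` is forced
set_option linter.dupNamespace false

namespace Summit.ResolutionOfSingularities.ResolutionOfSingularities.Theorems

open IsLocalRing Literature.AlgebraicGeometry.Resolution

/-- **The boundary components of a strict normal crossings hyperplane section are discrete
valuation rings.** Let `R` be a Noetherian domain and `t ∈ R` such that at every prime `Q ∋ t` the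
localization `R_Q` carries a part `x : Fin r → R_Q` (`r ≥ 1`) of a regular system of parameters with
`√(t R_Q) = (∏ x_l)`. Then for every minimal prime `q` over `(t)` the local ring `R_q` is a discrete
valuation ring: `dim R_q = ht q ≤ 1` by Krull's principal ideal theorem, a regular local ring of
dimension `≤ 1` is a principal ideal ring, and `x₀ ≠ 0` lies in its maximal ideal. [folklore] -/
theorem tropicalLinks_isDiscreteValuationRing_of_sncClause : ∀ (R : Type) [CommRing R] [IsDomain R] [IsNoetherianRing R] (t : R), (∀ (Q : Ideal R) [Q.IsPrime], t ∈ Q → ∃ (r : ℕ) (x : Fin r → Localization.AtPrime Q), 1 ≤ r ∧ Literature.AlgebraicGeometry.Resolution.IsRsopPart x ∧ (Ideal.span {algebraMap R (Localization.AtPrime Q) t}).radical = Ideal.span {∏ l, x l}) → ∀ q ∈ (Ideal.span {t}).minimalPrimes, ∀ (_ : q.IsPrime), IsDiscreteValuationRing (Localization.AtPrime q) := by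
  intro R _ _ _ t hsnc q hq hqp
  -- `t ∈ q`, so the clause applies at `Q := q`
  have ht : t ∈ q := (Ideal.IsMinimalPrime.le hq) (Ideal.mem_span_singleton_self t)
  obtain ⟨r, x, hr, hx, -⟩ := hsnc q ht
  haveI : IsRegularLocalRing (Localization.AtPrime q) := hx.isRegularLocalRing
  -- Krull's Hauptidealsatz: `dim R_q = ht q ≤ 1`
  have hheight : q.height ≤ 1 :=
    Ideal.height_le_one_of_isPrincipal_of_mem_minimalPrimes (Ideal.span {t}) q hq
  have hdim : ringKrullDim (Localization.AtPrime q) ≤ 1 := by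
    rw [IsLocalization.AtPrime.ringKrullDim_eq_height q (Localization.AtPrime q)]
    exact_mod_cast hheight
  -- a regular local ring of dimension `≤ 1` is a principal ideal ring
  haveI : IsPrincipalIdealRing (Localization.AtPrime q) := by
    refine ((tfae_of_isNoetherianRing_of_isLocalRing_of_isDomain
      (Localization.AtPrime q)).out 0 5).mpr ?_
    rw [← spanFinrank_maximalIdeal_eq_finrank_cotangentSpace]
    have h1 := (isRegularLocalRing_iff (Localization.AtPrime q)).mp ‹_›
    rw [← h1] at hdim
    exact_mod_cast hdim
  -- and it is not a field: `x₀ ≠ 0` lies in the maximal ideal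
  refine { not_a_field' := fun hbot => hx.ne_zero ⟨0, hr⟩ ?_ }
  have hmem := hx.mem_maximalIdeal ⟨0, hr⟩
  rw [hbot] at hmem
  exact (Submodule.mem_bot _).mp hmem

end Summit.ResolutionOfSingularities.ResolutionOfSingularities.Theorems
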